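import Summits.HodgeConjecture.CorCM.MultiFieldWeilOcticSlotsHeadline
import HarnessLib

/-!
# MULTI-FIELD WEIL ENGINE — OCTIC SLOTS, DEGREE FORM: the `2`-transitivity of `Aut(ℂ/τk)` on the `τ`-embeddings of an octic CM field `K ∋ k` from ONE degree —
# two `τ`-embeddings generating a field of degree `24` — and the sextic + octic + decic headline with this hypothesis

Cell `pub-hodgecm2` (COR-CM), seat b30 gen 38 (2026-08-25); count-neutral own lane MULTI-FIELD WEIL ENGINE (stem `MultiFieldWeil*`), sequel of
`CorCM/MultiFieldWeilOcticSlotsHeadline.lean` (Z3: `hodgeConjectureFor_biproduct_comp_of_sexticsOcticsDecics`, hypothesis `h2T` in automorphism form) and of gen 31's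
orbit counting `exists_ringEquiv_fix_pair_of_finrank` (`CorCM/MultiFieldWeilOrbitCounting.lean`).  Theorems only; no definition, no named fact, no `sorry`.  HONEST
FRAMING: conditional ONLY on the two displayed Markman binders; `HC_CM` is NOT proved and not asserted.

§1 **`h2T` FROM ONE DEGREE** (`twoTransitive_aut_of_finrank_pair`).  `k = Kf i₀` imaginary quadratic, `K_m ⊇ i_m(k)` with `[K_m : ℚ] = 2 n_m`; if for ONE pair `s₀ ≠ t₀` of
`τ`-embeddings of `K_m` the subfield `ℚ(τk)·s₀(K_m)·t₀(K_m)` of `ℂ` has degree `2 · n_m (n_m − 1)`, then for ALL pairs `s₁ ≠ s₂`, `s₁' ≠ s₂'` of `τ`-embeddings some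
automorphism of `ℂ` over `τ(k)` carries `s₁ ↦ s₁'`, `s₂ ↦ s₂'`.  For an OCTIC `K_m = k·F` (`F = K_m⁺` a totally real quartic) the degree is `24` exactly when two conjugates
of `F` generate a field of degree `12`, i.e. when the Galois group of `F` is `𝔄₄` or `𝔖₄` — the `2`-transitive quartic parts.

§2 **HEADLINE, DEGREE FORM** (`hodgeConjectureFor_biproduct_comp_of_sexticsOcticsDecics_of_finrank_pair`): Z3's headline with (i) replaced by: for every octic `K_m` some
two `τ`-embeddings `s₀ ≠ t₀` have `[ℚ(τk)·s₀(K_m)·t₀(K_m) : ℚ] = 24`; plus the `Hom = ∅` ∕ dominated variants.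

[cite: Lang2002, VI §1 Thm. 1.1, Cor. 1.6 and V §2 Thm. 2.8] [cite: DixonMortimer1996, §1.6; §3.3, Thm. 3.3A] [cite: Shimura1998, §18.2 Lemma (i)]
[cite: Markman2025SurveySecant, Thm. 1.2] [cite: Markman2025SecantWeil, Thm 1.5.1] [cite: Pohlmann1968, Thm 1] [cite: MoonenZarhin1995Duke, Thm. 2.4] [cite: MumfordAV1970, §19]

## References
* [Lang2002] S. Lang, *Algebra*, GTM 211, V §2 Thm. 2.8, VI §1 Thm. 1.1, Cor. 1.6.  [DixonMortimer1996] J. D. Dixon, B. Mortimer, *Permutation Groups*, GTM 163, §1.6, §3.3.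
  [Shimura1998] G. Shimura, *Abelian varieties with complex multiplication and modular functions*, §18.2 Lemma (i).  [Markman2025SurveySecant] E. Markman, arXiv:2509.23403,
  Thm. 1.2.  [Markman2025SecantWeil] E. Markman, Cycles on abelian 2n-folds of Weil type from secant sheaves on abelian n-folds, Thm 1.5.1.  [Pohlmann1968] H. Pohlmann,
  Ann. of Math. 88 (1968), Thm 1.  [MoonenZarhin1995Duke] B. Moonen, Yu. Zarhin, Duke Math. J. 77 (1995), Thm. 2.4.  [MumfordAV1970] D. Mumford, *Abelian Varieties*, §19.
-/

noncomputable section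

open CategoryTheory CategoryTheory.Limits NumberField IntermediateField

namespace Summit.HodgeConjecture.CorCM.MultiFieldWeil

open Finset
open Literature.AlgebraicGeometry Literature.AlgebraicGeometry.Motives Literature.AlgebraicGeometry.HodgeTheory
open Literature.AlgebraicGeometry.ComplexMultiplication (IsCMTypeRealisation)
open Literature.AlgebraicTopology.SingularHomology
open Literature.NumberTheory.ComplexMultiplication
open Summit.HodgeConjecture.CorCM.Census.MultiFieldWeil

open scoped Classical

/-! ## §1 `h2T` from one degree -/

section Degree

variable {I : Type} {r : ℕ} {Kf : I → Type} [∀ i, Field (Kf i)] [∀ i, NumberField (Kf i)] {i₀ : I} {is : Fin r → I} {τ : Kf i₀ →+* ℂ}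

/-- **`2`-TRANSITIVITY OF `Aut(ℂ/τk)` ON THE `τ`-EMBEDDINGS FROM ONE DEGREE.**  `[k : ℚ] = 2`, `[K_m : ℚ] = 2 n_m` along `i_m : k → K_m`; if for ONE pair `s₀ ≠ t₀` of
`τ`-embeddings of `K_m` the subfield `ℚ(τk) ⊔ ℚ(s₀(K_m) ∪ t₀(K_m))` of `ℂ` has degree `2 · n_m (n_m − 1)`, then any two pairs of distinct `τ`-embeddings of `K_m` are
interchanged by an automorphism of `ℂ` over `τ(k)` (gen 31's `exists_ringEquiv_fix_pair_of_finrank` with `M = ℚ(τk)`).  For an octic `K_m`: degree `24`, quartic part `𝔄₄`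
or `𝔖₄`. [cite: Lang2002, VI §1 Thm. 1.1, Cor. 1.6 and V §2 Thm. 2.8] [cite: DixonMortimer1996, §1.6] -/
theorem twoTransitive_aut_of_finrank_pair (h2 : Module.finrank ℚ (Kf i₀) = 2) (im : ∀ m : Fin r, Kf i₀ →+* Kf (is m)) (m : Fin r) {nm : ℕ}
    (hdeg : Module.finrank ℚ (Kf (is m)) = 2 * nm) {s₀ t₀ : Kf (is m) →+* ℂ} (hs₀ : s₀.comp (im m) = τ) (ht₀ : t₀.comp (im m) = τ) (hst₀ : s₀ ≠ t₀)
    (hdeg2 : Module.finrank ℚ ↥(adjoin ℚ (Set.range τ) ⊔ adjoin ℚ (Set.range s₀ ∪ Set.range t₀)) = 2 * (nm * (nm - 1)))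
    (s₁ s₂ s₁' s₂' : Kf (is m) →+* ℂ) (hs₁ : s₁.comp (im m) = τ) (hs₂ : s₂.comp (im m) = τ) (hs₁' : s₁'.comp (im m) = τ) (hs₂' : s₂'.comp (im m) = τ)
    (h₁₂ : s₁ ≠ s₂) (h₁₂' : s₁' ≠ s₂') :
    ∃ ρ : ℂ ≃+* ℂ, (ρ : ℂ →+* ℂ).comp τ = τ ∧ (ρ : ℂ →+* ℂ).comp s₁ = s₁' ∧ (ρ : ℂ →+* ℂ).comp s₂ = s₂' := by
  set M : IntermediateField ℚ ℂ := adjoin ℚ (Set.range τ) with hM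
  have hMdeg : Module.finrank ℚ M = 2 := by rw [hM, finrank_adjoin_range_ringHom, h2]
  haveI : FiniteDimensional ℚ M := Module.finite_of_finrank_pos (by rw [hMdeg]; exact Nat.succ_pos 1)
  have hτM : ∀ x, τ x ∈ M := fun x => subset_adjoin ℚ _ ⟨x, rfl⟩
  have hn : (Finset.univ.filter fun u : Kf (is m) →+* ℂ => u.comp (im m) = τ).card = nm := SexticOcticWeil.card_filter_comp_eq_of_finrank (im m) hdeg h2 τ
  obtain ⟨ρ, hρM, hρ₁, hρ₂⟩ := exists_ringEquiv_fix_pair_of_finrank M hτM hs₀ ht₀ hst₀ nm hn (by rw [hdeg2, hMdeg]) s₁ s₂ s₁' s₂' hs₁ hs₂ hs₁' hs₂' h₁₂ h₁₂'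
  exact ⟨ρ, RingHom.ext fun y => hρM _ (hτM y), hρ₁, hρ₂⟩

/-- **Octic slots: the binder `h2T` of Z3 from degree `24`.** [cite: Lang2002, VI §1 Thm. 1.1 and Cor. 1.6] [cite: DixonMortimer1996, §1.6] -/
theorem h2T_of_finrank_pair_octic (h2 : Module.finrank ℚ (Kf i₀) = 2) (im : ∀ m : Fin r, Kf i₀ →+* Kf (is m)) {n : Fin r → ℕ}
    (hdeg : ∀ m : Fin r, Module.finrank ℚ (Kf (is m)) = 2 * n m)
    (h24 : ∀ m : Fin r, n m = 4 → ∃ s₀ t₀ : Kf (is m) →+* ℂ, s₀.comp (im m) = τ ∧ t₀.comp (im m) = τ ∧ s₀ ≠ t₀ ∧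
      Module.finrank ℚ ↥(adjoin ℚ (Set.range τ) ⊔ adjoin ℚ (Set.range s₀ ∪ Set.range t₀)) = 24)
    (m : Fin r) (h4 : n m = 4) (s₁ s₂ s₁' s₂' : Kf (is m) →+* ℂ) (hs₁ : s₁.comp (im m) = τ) (hs₂ : s₂.comp (im m) = τ) (hs₁' : s₁'.comp (im m) = τ)
    (hs₂' : s₂'.comp (im m) = τ) (h₁₂ : s₁ ≠ s₂) (h₁₂' : s₁' ≠ s₂') :
    ∃ ρ : ℂ ≃+* ℂ, (ρ : ℂ →+* ℂ).comp τ = τ ∧ (ρ : ℂ →+* ℂ).comp s₁ = s₁' ∧ (ρ : ℂ →+* ℂ).comp s₂ = s₂' := by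
  obtain ⟨s₀, t₀, hs₀, ht₀, hst₀, hd⟩ := h24 m h4
  exact twoTransitive_aut_of_finrank_pair h2 im m (nm := 4) (by rw [hdeg m, h4]) hs₀ ht₀ hst₀ (by rw [hd]) s₁ s₂ s₁' s₂' hs₁ hs₂ hs₁' hs₂' h₁₂ h₁₂'

end Degree

/-! ## §2 The headline, degree form -/

section Headline

variable {I : Type} {r : ℕ} {Kf : I → Type} [∀ i, Field (Kf i)] [∀ i, NumberField (Kf i)] [∀ i, IsCMField (Kf i)]
  {i₀ : I} {is : Fin r → I} {τ : Kf i₀ →+* ℂ}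
  {A : Fin (r + 1) → AbelianVariety ℂ} {Φ : ∀ j : Fin (r + 1), CMType (Kf (mfSlots i₀ is j))}
  {ι : ∀ j, 𝓞 (Kf (mfSlots i₀ is j)) →+* End (A j)}
  {θ : ∀ j, Kf (mfSlots i₀ is j) →+* Module.End ℂ (complexBetti (A j).X 1)}

/-- **HEADLINE — SEXTICS, OCTICS WITH TWO CONJUGATES OF DEGREE `24` OVER `ℚ` TOGETHER, DECICS; GIVEN ONLY MARKMAN'S TWO THEOREMS.**  As
`hodgeConjectureFor_biproduct_comp_of_sexticsOcticsDecics`, with hypothesis (i) in DEGREE FORM: for every octic `K_m` some two distinct `τ`-embeddings `s₀, t₀` have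
`[ℚ(τk)·s₀(K_m)·t₀(K_m) : ℚ] = 24` (quartic part `𝔄₄` or `𝔖₄`); (ii) for `m₀ ≠ m` of equal degree, and for `K_{m₀}` octic with `K_m` sextic, some `τ`-embedding of `K_m` takes
some value outside `L(K_{m₀})`.  Then HC holds for EVERY product of copies `⨁_j A(κ j)`.  `HC_CM` is NOT asserted. [cite: Markman2025SurveySecant, Thm. 1.2]
[cite: Markman2025SecantWeil, Thm 1.5.1] [cite: Pohlmann1968, Thm 1] [cite: MoonenZarhin1995Duke, Thm. 2.4] [cite: Lang2002, VI §1 Thm. 1.1] [cite: DixonMortimer1996, §3.3, Thm. 3.3A] -/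
theorem hodgeConjectureFor_biproduct_comp_of_sexticsOcticsDecics_of_finrank_pair (hW4 : Markman2025_weilClasses_algebraic_abelianFourfold)
    (hM6 : Markman2025_weilClasses_algebraic_hyperbolicSixfold) (n p : Fin r → ℕ)
    (hnp : ∀ m, (n m = 3 ∧ p m = 1) ∨ (n m = 4 ∧ p m = 1) ∨ (n m = 4 ∧ p m = 2) ∨ (n m = 5 ∧ p m = 2))
    {N : ℕ} (κ : Fin N → Fin (r + 1)) (h2 : Module.finrank ℚ (Kf i₀) = 2) (hdeg : ∀ m : Fin r, Module.finrank ℚ (Kf (is m)) = 2 * n m)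
    (im : ∀ m : Fin r, Kf i₀ →+* Kf (is m)) (hA : ∀ j, IsCMTypeRealisation (Φ j) (A j) (ι j) (θ j)) (hΨ : ∀ σ : Kf i₀ →+* ℂ, σ ∈ (Φ 0).1 ↔ σ = τ)
    (hp : ∀ m : Fin r, (Finset.univ.filter fun s : Kf (is m) →+* ℂ => s.comp (im m) = τ ∧ s ∈ (Φ m.succ).1).card = p m)
    (h24 : ∀ m : Fin r, n m = 4 → ∃ s₀ t₀ : Kf (is m) →+* ℂ, s₀.comp (im m) = τ ∧ t₀.comp (im m) = τ ∧ s₀ ≠ t₀ ∧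
      Module.finrank ℚ ↥(adjoin ℚ (Set.range τ) ⊔ adjoin ℚ (Set.range s₀ ∪ Set.range t₀)) = 24)
    (hout : ∀ (m₀ m : Fin r), m₀ ≠ m → (n m₀ = n m ∨ (n m₀ = 4 ∧ n m = 3)) →
      ∃ s : Kf (is m) →+* ℂ, s.comp (im m) = τ ∧ ∃ x, s x ∉ normalClosure ℚ (Kf (is m₀)) ℂ) :
    HodgeConjectureFor (⨁ fun j => A (κ j)).dim (⨁ fun j => A (κ j)).X :=
  hodgeConjectureFor_biproduct_comp_of_sexticsOcticsDecics hW4 hM6 n p hnp κ h2 hdeg im hA hΨ hp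
    (fun m h4 => h2T_of_finrank_pair_octic h2 im hdeg h24 m h4) hout

/-- **Dominated form, degree form.** [cite: Markman2025SurveySecant, Thm. 1.2] [cite: Markman2025SecantWeil, Thm 1.5.1] [cite: MumfordAV1970, §19] -/
theorem hodgeConjectureFor_of_avDominatedBy_comp_of_sexticsOcticsDecics_of_finrank_pair (hW4 : Markman2025_weilClasses_algebraic_abelianFourfold)
    (hM6 : Markman2025_weilClasses_algebraic_hyperbolicSixfold) (n p : Fin r → ℕ)
    (hnp : ∀ m, (n m = 3 ∧ p m = 1) ∨ (n m = 4 ∧ p m = 1) ∨ (n m = 4 ∧ p m = 2) ∨ (n m = 5 ∧ p m = 2))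
    {N : ℕ} (κ : Fin N → Fin (r + 1)) (h2 : Module.finrank ℚ (Kf i₀) = 2) (hdeg : ∀ m : Fin r, Module.finrank ℚ (Kf (is m)) = 2 * n m)
    (im : ∀ m : Fin r, Kf i₀ →+* Kf (is m)) (hA : ∀ j, IsCMTypeRealisation (Φ j) (A j) (ι j) (θ j)) (hΨ : ∀ σ : Kf i₀ →+* ℂ, σ ∈ (Φ 0).1 ↔ σ = τ)
    (hp : ∀ m : Fin r, (Finset.univ.filter fun s : Kf (is m) →+* ℂ => s.comp (im m) = τ ∧ s ∈ (Φ m.succ).1).card = p m)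
    (h24 : ∀ m : Fin r, n m = 4 → ∃ s₀ t₀ : Kf (is m) →+* ℂ, s₀.comp (im m) = τ ∧ t₀.comp (im m) = τ ∧ s₀ ≠ t₀ ∧
      Module.finrank ℚ ↥(adjoin ℚ (Set.range τ) ⊔ adjoin ℚ (Set.range s₀ ∪ Set.range t₀)) = 24)
    (hout : ∀ (m₀ m : Fin r), m₀ ≠ m → (n m₀ = n m ∨ (n m₀ = 4 ∧ n m = 3)) →
      ∃ s : Kf (is m) →+* ℂ, s.comp (im m) = τ ∧ ∃ x, s x ∉ normalClosure ℚ (Kf (is m₀)) ℂ)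
    {X : AbelianVariety ℂ} (hX : Domination.AVDominatedBy X (⨁ fun j => A (κ j))) : HodgeConjectureFor X.dim X.X :=
  Domination.hodgeConjectureFor_of_avDominatedBy
    (hodgeConjectureFor_biproduct_comp_of_sexticsOcticsDecics_of_finrank_pair hW4 hM6 n p hnp κ h2 hdeg im hA hΨ hp h24 hout) hX

/-- **`Hom = ∅` + DEGREE FORM**: (ii) for sextic–sextic and decic–decic pairs from `Hom(K_m, K_{m₀}) = ∅`; octic–octic and octic→sextic pairs by a value outside the closure;
(i) by degree `24`.  `HC_CM` is NOT asserted. [cite: Markman2025SurveySecant, Thm. 1.2] [cite: Markman2025SecantWeil, Thm 1.5.1] [cite: Dodson1984, §1.1 Imprimitivity Theorem and §5.1.2 Theorem]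
[cite: Lang2002, VI §1 Thm. 1.1] [cite: DixonMortimer1996, §3.3, Thm. 3.3A] -/
theorem hodgeConjectureFor_biproduct_comp_of_sexticsOcticsDecics_of_isEmpty_ringHom_of_finrank_pair (hW4 : Markman2025_weilClasses_algebraic_abelianFourfold)
    (hM6 : Markman2025_weilClasses_algebraic_hyperbolicSixfold) (n p : Fin r → ℕ)
    (hnp : ∀ m, (n m = 3 ∧ p m = 1) ∨ (n m = 4 ∧ p m = 1) ∨ (n m = 4 ∧ p m = 2) ∨ (n m = 5 ∧ p m = 2))
    {N : ℕ} (κ : Fin N → Fin (r + 1)) (h2 : Module.finrank ℚ (Kf i₀) = 2) (hdeg : ∀ m : Fin r, Module.finrank ℚ (Kf (is m)) = 2 * n m)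
    (im : ∀ m : Fin r, Kf i₀ →+* Kf (is m)) (hA : ∀ j, IsCMTypeRealisation (Φ j) (A j) (ι j) (θ j)) (hΨ : ∀ σ : Kf i₀ →+* ℂ, σ ∈ (Φ 0).1 ↔ σ = τ)
    (hp : ∀ m : Fin r, (Finset.univ.filter fun s : Kf (is m) →+* ℂ => s.comp (im m) = τ ∧ s ∈ (Φ m.succ).1).card = p m)
    (h24 : ∀ m : Fin r, n m = 4 → ∃ s₀ t₀ : Kf (is m) →+* ℂ, s₀.comp (im m) = τ ∧ t₀.comp (im m) = τ ∧ s₀ ≠ t₀ ∧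
      Module.finrank ℚ ↥(adjoin ℚ (Set.range τ) ⊔ adjoin ℚ (Set.range s₀ ∪ Set.range t₀)) = 24)
    (hiso : ∀ (m₀ m : Fin r), m₀ ≠ m → n m₀ = n m → (n m = 3 ∨ n m = 5) → IsEmpty (Kf (is m) →+* Kf (is m₀)))
    (hout4 : ∀ (m₀ m : Fin r), m₀ ≠ m → n m₀ = 4 → (n m = 4 ∨ n m = 3) →
      ∃ s : Kf (is m) →+* ℂ, s.comp (im m) = τ ∧ ∃ x, s x ∉ normalClosure ℚ (Kf (is m₀)) ℂ) :
    HodgeConjectureFor (⨁ fun j => A (κ j)).dim (⨁ fun j => A (κ j)).X :=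
  hodgeConjectureFor_biproduct_comp_of_sexticsOcticsDecics_of_isEmpty_ringHom hW4 hM6 n p hnp κ h2 hdeg im hA hΨ hp
    (fun m h4 => h2T_of_finrank_pair_octic h2 im hdeg h24 m h4) hiso hout4

/-- **Dominated form.** [cite: Markman2025SurveySecant, Thm. 1.2] [cite: Markman2025SecantWeil, Thm 1.5.1] [cite: MumfordAV1970, §19] -/
theorem hodgeConjectureFor_of_avDominatedBy_comp_of_sexticsOcticsDecics_of_isEmpty_ringHom_of_finrank_pair (hW4 : Markman2025_weilClasses_algebraic_abelianFourfold)
    (hM6 : Markman2025_weilClasses_algebraic_hyperbolicSixfold) (n p : Fin r → ℕ)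
    (hnp : ∀ m, (n m = 3 ∧ p m = 1) ∨ (n m = 4 ∧ p m = 1) ∨ (n m = 4 ∧ p m = 2) ∨ (n m = 5 ∧ p m = 2))
    {N : ℕ} (κ : Fin N → Fin (r + 1)) (h2 : Module.finrank ℚ (Kf i₀) = 2) (hdeg : ∀ m : Fin r, Module.finrank ℚ (Kf (is m)) = 2 * n m)
    (im : ∀ m : Fin r, Kf i₀ →+* Kf (is m)) (hA : ∀ j, IsCMTypeRealisation (Φ j) (A j) (ι j) (θ j)) (hΨ : ∀ σ : Kf i₀ →+* ℂ, σ ∈ (Φ 0).1 ↔ σ = τ)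
    (hp : ∀ m : Fin r, (Finset.univ.filter fun s : Kf (is m) →+* ℂ => s.comp (im m) = τ ∧ s ∈ (Φ m.succ).1).card = p m)
    (h24 : ∀ m : Fin r, n m = 4 → ∃ s₀ t₀ : Kf (is m) →+* ℂ, s₀.comp (im m) = τ ∧ t₀.comp (im m) = τ ∧ s₀ ≠ t₀ ∧
      Module.finrank ℚ ↥(adjoin ℚ (Set.range τ) ⊔ adjoin ℚ (Set.range s₀ ∪ Set.range t₀)) = 24)
    (hiso : ∀ (m₀ m : Fin r), m₀ ≠ m → n m₀ = n m → (n m = 3 ∨ n m = 5) → IsEmpty (Kf (is m) →+* Kf (is m₀)))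
    (hout4 : ∀ (m₀ m : Fin r), m₀ ≠ m → n m₀ = 4 → (n m = 4 ∨ n m = 3) →
      ∃ s : Kf (is m) →+* ℂ, s.comp (im m) = τ ∧ ∃ x, s x ∉ normalClosure ℚ (Kf (is m₀)) ℂ)
    {X : AbelianVariety ℂ} (hX : Domination.AVDominatedBy X (⨁ fun j => A (κ j))) : HodgeConjectureFor X.dim X.X :=
  Domination.hodgeConjectureFor_of_avDominatedBy
    (hodgeConjectureFor_biproduct_comp_of_sexticsOcticsDecics_of_isEmpty_ringHom_of_finrank_pair hW4 hM6 n p hnp κ h2 hdeg im hA hΨ hp h24 hiso hout4) hX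

/-- **OCTIC FIELDS ONLY — ANY NUMBER OF `(1,3)`- AND `(2,2)`-FOURFOLDS OVER OCTIC CM FIELDS THROUGH `k` WITH QUARTIC PART `𝔄₄` OR `𝔖₄`, EACH WITH A `τ`-EMBEDDING
TAKING A VALUE OUTSIDE THE GALOIS CLOSURE OF EACH OTHER; GIVEN ONLY MARKMAN'S TWO THEOREMS.**  `k = Kf i₀` imaginary quadratic, `E = A 0 ⊨ (k; {τ})`, `B_m = A (m+1) ⊨ (K_m; Φ (m+1))`
over OCTIC CM fields `K_m ⊇ i_m(k)` with `1` or `2` members of `Φ (m+1)` over `τ` (CM fourfolds of `k`-signature `(1,3)` — Markman sixfold — or `(2,2)` — Markman fourfold);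
for every `m` two `τ`-embeddings generate with `τ(k)` a field of degree `24`; for `m₀ ≠ m` some `τ`-embedding of `K_m` takes some value outside `L(K_{m₀})`.  Then HC holds for
EVERY product of copies `E^a × ∏_m B_m^{b_m}` — several octic FIELDS at once (gens 18–25 treated several types over ONE octic field).  `HC_CM` is NOT asserted.
[cite: Markman2025SurveySecant, Thm. 1.2] [cite: Markman2025SecantWeil, Thm 1.5.1] [cite: Pohlmann1968, Thm 1] [cite: MoonenZarhin1995Duke, Thm. 2.4] [cite: Lang2002, VI §1 Thm. 1.1] -/
theorem hodgeConjectureFor_biproduct_comp_of_octics_of_outside_of_finrank_pair (hW4 : Markman2025_weilClasses_algebraic_abelianFourfold)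
    (hM6 : Markman2025_weilClasses_algebraic_hyperbolicSixfold) (p : Fin r → ℕ) (hp12 : ∀ m, p m = 1 ∨ p m = 2)
    {N : ℕ} (κ : Fin N → Fin (r + 1)) (h2 : Module.finrank ℚ (Kf i₀) = 2) (h8 : ∀ m : Fin r, Module.finrank ℚ (Kf (is m)) = 8)
    (im : ∀ m : Fin r, Kf i₀ →+* Kf (is m)) (hA : ∀ j, IsCMTypeRealisation (Φ j) (A j) (ι j) (θ j)) (hΨ : ∀ σ : Kf i₀ →+* ℂ, σ ∈ (Φ 0).1 ↔ σ = τ)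
    (hp : ∀ m : Fin r, (Finset.univ.filter fun s : Kf (is m) →+* ℂ => s.comp (im m) = τ ∧ s ∈ (Φ m.succ).1).card = p m)
    (h24 : ∀ m : Fin r, ∃ s₀ t₀ : Kf (is m) →+* ℂ, s₀.comp (im m) = τ ∧ t₀.comp (im m) = τ ∧ s₀ ≠ t₀ ∧
      Module.finrank ℚ ↥(adjoin ℚ (Set.range τ) ⊔ adjoin ℚ (Set.range s₀ ∪ Set.range t₀)) = 24)
    (hout : ∀ (m₀ m : Fin r), m₀ ≠ m → ∃ s : Kf (is m) →+* ℂ, s.comp (im m) = τ ∧ ∃ x, s x ∉ normalClosure ℚ (Kf (is m₀)) ℂ) :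
    HodgeConjectureFor (⨁ fun j => A (κ j)).dim (⨁ fun j => A (κ j)).X :=
  hodgeConjectureFor_biproduct_comp_of_sexticsOcticsDecics_of_finrank_pair hW4 hM6 (fun _ => 4) p
    (fun m => (hp12 m).elim (fun h => Or.inr (Or.inl ⟨rfl, h⟩)) fun h => Or.inr (Or.inr (Or.inl ⟨rfl, h⟩))) κ h2 (fun m => by rw [h8 m]) im hA hΨ hp
    (fun m _ => h24 m) fun m₀ m hm _ => hout m₀ m hm

/-- **Dominated form, octic fields only.** [cite: Markman2025SurveySecant, Thm. 1.2] [cite: Markman2025SecantWeil, Thm 1.5.1] [cite: MumfordAV1970, §19] -/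
theorem hodgeConjectureFor_of_avDominatedBy_comp_of_octics_of_outside_of_finrank_pair (hW4 : Markman2025_weilClasses_algebraic_abelianFourfold)
    (hM6 : Markman2025_weilClasses_algebraic_hyperbolicSixfold) (p : Fin r → ℕ) (hp12 : ∀ m, p m = 1 ∨ p m = 2)
    {N : ℕ} (κ : Fin N → Fin (r + 1)) (h2 : Module.finrank ℚ (Kf i₀) = 2) (h8 : ∀ m : Fin r, Module.finrank ℚ (Kf (is m)) = 8)
    (im : ∀ m : Fin r, Kf i₀ →+* Kf (is m)) (hA : ∀ j, IsCMTypeRealisation (Φ j) (A j) (ι j) (θ j)) (hΨ : ∀ σ : Kf i₀ →+* ℂ, σ ∈ (Φ 0).1 ↔ σ = τ)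
    (hp : ∀ m : Fin r, (Finset.univ.filter fun s : Kf (is m) →+* ℂ => s.comp (im m) = τ ∧ s ∈ (Φ m.succ).1).card = p m)
    (h24 : ∀ m : Fin r, ∃ s₀ t₀ : Kf (is m) →+* ℂ, s₀.comp (im m) = τ ∧ t₀.comp (im m) = τ ∧ s₀ ≠ t₀ ∧
      Module.finrank ℚ ↥(adjoin ℚ (Set.range τ) ⊔ adjoin ℚ (Set.range s₀ ∪ Set.range t₀)) = 24)
    (hout : ∀ (m₀ m : Fin r), m₀ ≠ m → ∃ s : Kf (is m) →+* ℂ, s.comp (im m) = τ ∧ ∃ x, s x ∉ normalClosure ℚ (Kf (is m₀)) ℂ)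
    {X : AbelianVariety ℂ} (hX : Domination.AVDominatedBy X (⨁ fun j => A (κ j))) : HodgeConjectureFor X.dim X.X :=
  Domination.hodgeConjectureFor_of_avDominatedBy
    (hodgeConjectureFor_biproduct_comp_of_octics_of_outside_of_finrank_pair hW4 hM6 p hp12 κ h2 h8 im hA hΨ hp h24 hout) hX

end Headline

end Summit.HodgeConjecture.CorCM.MultiFieldWeil

end
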